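import Summits.Ventures.HodgeRepro2.T5SU11JacobiPhaseLawRate

/-!
# The rate of the limit law of the rescaled phase, uniformly in `0 ≤ λ ≤ 2`: `|T_{k,λ}(x) − e^{−x}| ≤ (2 + 3x) e^{−x/2}/k`

`T5SU11JacobiPhaseLawAsymptotic` proves `T_{k,λ}(x) := P_{k,λ}(k log|a| > x) → e^{−x}` by dominated convergence.
This file makes it quantitative: the general-threshold bounds of `T5SU11JacobiPhaseLawRate` at `τ = x/k`,
`e^{−(k−2)x/k} = e^{−x} e^{2x/k}`, give for `k ≥ 3`, `0 ≤ λ ≤ 2`, `x ≥ 0` the two-sided bound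

  **`e^{−x} e^{2x/k} (1 − c(x/k + 1/(k − 2))) ≤ T_{k,λ}(x) ≤ e^{−x} e^{2x/k}/(1 − c/(k − 2))`**,  `c = λ(2 − λ)/2`

(`tail_prob_ge`, `tail_prob_le`), and hence, for `k ≥ 4`, the **rate**

  **`|T_{k,λ}(x) − e^{−x}| ≤ (2 + 3x) e^{−x/2}/k`**   (`abs_tail_prob_sub_exp_le`, on the group `abs_phase_tail_prob_sub_exp_le`)

— the convergence in law of the rescaled phase `k log|a|` to `Exp(1)` is of order `1/k`, with a constant
uniform in the spectral parameter `λ ∈ [0, 2]` (which covers the owner's weight-3 model `λ = 1`,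
`abs_tail_prob_one_sub_exp_le`, and the Jensen range of the spherical functions). At `λ = 0` the tail is
exactly `e^{−x(k−2)/k}` and the bound is sharp to the constant. Nothing is claimed about (N).

Blind lane: Mathlib + the HodgeRepro2 prefix only; no sorry; axioms ⊆ {propext, Classical.choice,
Quot.sound}.
-/

namespace Summit.Ventures.HodgeRepro2.T5SU11JacobiPhaseLawRateScaled

open MeasureTheory MeasureTheory.Measure Metric Set Filter Topology
open T5SU11Unimodular T5SU11Fibration T5SU11Cartan T5SU11OneParameter T5SU11CartanProjection T5HaarCircle
  T5BergmanCoefficient T5SU11FibrationHaar T5SU11SphericalFunction T5SU11SphericalSymmetry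
  T5SU11SphericalBounds T5SU11SphericalContinuous T5SU11JacobiIwasawa T5SU11JacobiTransform
  T5SU11JacobiWeight T5SU11KFiniteMajorantPow T5SU11JacobiLaplacePhase T5SU11JacobiPhaseTailGroup
  T5SU11JacobiPhaseTailRate T5SU11JacobiPhaseTailXi T5SU11JacobiPhaseLipschitz
  T5SU11JacobiPhaseLawRate
open scoped Real

section measure

variable [MeasurableSpace Circle] [BorelSpace Circle]

/-! ### The rescaled threshold `x/k` -/

/-- **THE TAIL PROBABILITY FROM ABOVE**: for `k ≥ 3`, `0 ≤ λ ≤ 2`, `x ≥ 0`,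
`T_{k,λ}(x) = N(x/k)/N(0) ≤ e^{−x} e^{2x/k}/(1 − c/(k − 2))`, `c = λ(2 − λ)/2`. -/
theorem tail_prob_le {k lam x : ℝ} (hk : 3 ≤ k) (h0 : 0 ≤ lam) (h2 : lam ≤ 2) (hx : 0 ≤ x) :
    (∫ s in Ioi (x / k), Real.exp (-((k - 2) * s)) * sphPhase lam s)
        / ∫ s in Ioi (0 : ℝ), Real.exp (-((k - 2) * s)) * sphPhase lam s
      ≤ Real.exp (-x) * Real.exp (2 * x / k) / (1 - lam * (2 - lam) / 2 / (k - 2)) := by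
  have hk0 : 0 < k := by linarith
  have hexp : Real.exp (-((k - 2) * (x / k))) = Real.exp (-x) * Real.exp (2 * x / k) := by
    rw [← Real.exp_add]
    congr 1
    field_simp
    ring
  rw [← hexp]
  exact tail_prob_le' hk h0 h2 (div_nonneg hx hk0.le)

/-- **THE TAIL PROBABILITY FROM BELOW**: for `k ≥ 3`, `0 ≤ λ ≤ 2`, `x ≥ 0`,
`e^{−x} e^{2x/k} (1 − c(x/k + 1/(k − 2))) ≤ T_{k,λ}(x) = N(x/k)/N(0)`, `c = λ(2 − λ)/2`. -/
theorem tail_prob_ge {k lam x : ℝ} (hk : 3 ≤ k) (h0 : 0 ≤ lam) (h2 : lam ≤ 2) (hx : 0 ≤ x) :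
    Real.exp (-x) * Real.exp (2 * x / k) * (1 - lam * (2 - lam) / 2 * (x / k + 1 / (k - 2)))
      ≤ (∫ s in Ioi (x / k), Real.exp (-((k - 2) * s)) * sphPhase lam s)
        / ∫ s in Ioi (0 : ℝ), Real.exp (-((k - 2) * s)) * sphPhase lam s := by
  have hk0 : 0 < k := by linarith
  have hexp : Real.exp (-((k - 2) * (x / k))) = Real.exp (-x) * Real.exp (2 * x / k) := by
    rw [← Real.exp_add]
    congr 1
    field_simp
    ring
  rw [← hexp]
  exact tail_prob_ge' hk h0 h2 (div_nonneg hx hk0.le)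

/-! ### The rate `O(1/k)` -/

/-- **THE RATE OF THE LIMIT LAW, UNIFORMLY IN `0 ≤ λ ≤ 2`**: for `k ≥ 4` and `x ≥ 0`,
`|T_{k,λ}(x) − e^{−x}| ≤ (2 + 3x) e^{−x/2}/k`. -/
theorem abs_tail_prob_sub_exp_le {k lam x : ℝ} (hk : 4 ≤ k) (h0 : 0 ≤ lam) (h2 : lam ≤ 2) (hx : 0 ≤ x) :
    |(∫ s in Ioi (x / k), Real.exp (-((k - 2) * s)) * sphPhase lam s)
        / (∫ s in Ioi (0 : ℝ), Real.exp (-((k - 2) * s)) * sphPhase lam s) - Real.exp (-x)|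
      ≤ (2 + 3 * x) * Real.exp (-(x / 2)) / k := by
  have hk3 : 3 ≤ k := by linarith
  have hr : 0 < k - 2 := by linarith
  have hk0 : 0 < k := by linarith
  set c : ℝ := lam * (2 - lam) / 2 with hc
  have hc0 : 0 ≤ c := by rw [hc]; nlinarith
  have hc1 : c ≤ 1 / 2 := by rw [hc]; nlinarith [sq_nonneg (lam - 1)]
  -- the two-sided bound
  have hup := tail_prob_le hk3 h0 h2 hx
  have hlo := tail_prob_ge hk3 h0 h2 hx
  set T : ℝ := (∫ s in Ioi (x / k), Real.exp (-((k - 2) * s)) * sphPhase lam s)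
    / (∫ s in Ioi (0 : ℝ), Real.exp (-((k - 2) * s)) * sphPhase lam s) with hT
  set A : ℝ := Real.exp (-x) with hA
  set E : ℝ := Real.exp (2 * x / k) with hE
  set η : ℝ := c / (k - 2) with hη
  set δ : ℝ := c * (x / k + 1 / (k - 2)) with hδ
  -- the elementary facts
  have hApos : 0 < A := Real.exp_pos _
  have hE1 : 1 ≤ E := Real.one_le_exp (by positivity)
  have hEle : A * E ≤ Real.exp (-(x / 2)) := by
    rw [hA, hE, ← Real.exp_add, Real.exp_le_exp]
    have : 2 * x / k ≤ x / 2 := by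
      rw [div_le_iff₀ hk0]
      nlinarith
    linarith
  have hAle : A ≤ Real.exp (-(x / 2)) := by
    rw [hA, Real.exp_le_exp]
    linarith
  have hEsub : E - 1 ≤ 2 * x / k * E := exp_sub_one_le_mul_exp _
  have hη0 : 0 ≤ η := div_nonneg hc0 hr.le
  have hη1 : η ≤ 1 / k := by
    rw [hη, div_le_div_iff₀ hr hk0]
    nlinarith
  have hηhalf : η ≤ 1 / 2 := by
    refine hη1.trans ?_
    rw [div_le_div_iff₀ hk0 two_pos]
    linarith
  have hδ0 : 0 ≤ δ := by
    rw [hδ]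
    exact mul_nonneg hc0 (by positivity)
  have hδle : δ ≤ (x + 2) / (2 * k) := by
    rw [hδ]
    have h1 : 1 / (k - 2) ≤ 2 / k := by
      rw [div_le_div_iff₀ hr hk0]
      linarith
    have h3 : x / k + 1 / (k - 2) ≤ (x + 2) / k := by
      rw [add_div]
      linarith
    calc c * (x / k + 1 / (k - 2)) ≤ 1 / 2 * ((x + 2) / k) :=
          mul_le_mul hc1 h3 (by positivity) (by norm_num)
      _ = (x + 2) / (2 * k) := by ring
  have hk1 : 1 / k ≤ 1 / 4 := by
    rw [div_le_div_iff₀ hk0 (by norm_num : (0 : ℝ) < 4)]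
    linarith
  -- the upper bound `T − A ≤ (2 + 3x) e^{−x/2}/k`
  have hU : T - A ≤ (2 + 3 * x) * Real.exp (-(x / 2)) / k := by
    have h1 : T ≤ A * E * (1 + 2 * η) := by
      refine hup.trans ?_
      rw [div_eq_mul_one_div]
      exact mul_le_mul_of_nonneg_left (inv_one_sub_le hη0 hηhalf) (by positivity)
    have h2' : A * E * (1 + 2 * η) - A = A * ((E - 1) * (1 + 2 * η) + 2 * η) := by ring
    have h3 : (E - 1) * (1 + 2 * η) + 2 * η ≤ 2 * x / k * E * (3 / 2) + 2 / k := by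
      have hE0 : 0 ≤ E - 1 := by linarith
      have h2η : 2 * η ≤ 2 / k := by
        rw [div_eq_mul_one_div (2 : ℝ) k]
        linarith
      have : (E - 1) * (1 + 2 * η) ≤ (2 * x / k * E) * (3 / 2) := by
        apply mul_le_mul hEsub _ (by linarith) (by positivity)
        linarith
      linarith
    have h4 : A * (2 * x / k * E * (3 / 2) + 2 / k) = (3 * x * (A * E) + 2 * A) / k := by
      field_simp
    calc T - A ≤ A * E * (1 + 2 * η) - A := by linarith
      _ = A * ((E - 1) * (1 + 2 * η) + 2 * η) := h2'
      _ ≤ A * (2 * x / k * E * (3 / 2) + 2 / k) := mul_le_mul_of_nonneg_left h3 hApos.le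
      _ = (3 * x * (A * E) + 2 * A) / k := h4
      _ ≤ (3 * x * Real.exp (-(x / 2)) + 2 * Real.exp (-(x / 2))) / k := by
          apply div_le_div_of_nonneg_right _ hk0.le
          nlinarith
      _ = (2 + 3 * x) * Real.exp (-(x / 2)) / k := by ring
  -- the lower bound `A − T ≤ (2 + 3x) e^{−x/2}/k`
  have hL : A - T ≤ (2 + 3 * x) * Real.exp (-(x / 2)) / k := by
    have h1 : A * E * (1 - δ) ≤ T := hlo
    have h2' : A - A * E * (1 - δ) ≤ A * E * δ := by
      have : A * E * (1 - δ) = A * E - A * E * δ := by ring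
      nlinarith
    have h3 : A * E * δ ≤ Real.exp (-(x / 2)) * ((x + 2) / (2 * k)) :=
      mul_le_mul hEle hδle hδ0 (Real.exp_pos _).le
    have h4 : Real.exp (-(x / 2)) * ((x + 2) / (2 * k)) ≤ (2 + 3 * x) * Real.exp (-(x / 2)) / k := by
      rw [show Real.exp (-(x / 2)) * ((x + 2) / (2 * k)) = ((x + 2) / 2) * Real.exp (-(x / 2)) / k by
        field_simp]
      apply div_le_div_of_nonneg_right _ hk0.le
      apply mul_le_mul_of_nonneg_right _ (Real.exp_pos _).le
      linarith
    linarith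
  rw [abs_le]
  constructor <;> linarith

/-- **ON THE GROUP**: for `k ≥ 4`, `0 ≤ λ ≤ 2`, `x ≥ 0`,
`|P_{k,λ}(k log|a| > x) − e^{−x}| ≤ (2 + 3x) e^{−x/2}/k` for the probability measure `m_k φ_λ dν/m̂_k(λ)`. -/
theorem abs_phase_tail_prob_sub_exp_le {k lam x : ℝ} (hk : 4 ≤ k) (h0 : 0 ≤ lam) (h2 : lam ≤ 2)
    (hx : 0 ≤ x) :
    |(∫ g in {g : SU11 | x / k < Real.log ‖mat g 0 0‖},
          (1 - ‖orbit g‖ ^ 2) ^ (k / 2) * sph lam g ∂(nu haarCircle))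
        / (∫ g, (1 - ‖orbit g‖ ^ 2) ^ (k / 2) * sph lam g ∂(nu haarCircle)) - Real.exp (-x)|
      ≤ (2 + 3 * x) * Real.exp (-(x / 2)) / k := by
  have hk0 : 0 < k := by linarith
  rw [integral_phase_tail_eq (by linarith) (by linarith) (by linarith) (div_nonneg hx hk0.le),
    jacobi_eq_laplace_phase (by linarith) (by linarith) (by linarith),
    mul_div_mul_left _ _ (by positivity : (2 * π : ℝ) ≠ 0)]
  exact abs_tail_prob_sub_exp_le hk h0 h2 hx

/-- At the owner's parameter `λ = 1` (Harish-Chandra's `Ξ`): `|T_{k,1}(x) − e^{−x}| ≤ (2 + 3x) e^{−x/2}/k`. -/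
theorem abs_tail_prob_one_sub_exp_le {k x : ℝ} (hk : 4 ≤ k) (hx : 0 ≤ x) :
    |(∫ s in Ioi (x / k), Real.exp (-((k - 2) * s)) * sphPhase 1 s)
        / (∫ s in Ioi (0 : ℝ), Real.exp (-((k - 2) * s)) * sphPhase 1 s) - Real.exp (-x)|
      ≤ (2 + 3 * x) * Real.exp (-(x / 2)) / k :=
  abs_tail_prob_sub_exp_le hk (by norm_num) (by norm_num) hx

end measure

end Summit.Ventures.HodgeRepro2.T5SU11JacobiPhaseLawRateScaled
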